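import Mathlib
import Summits.NavierStokesRegularity.NavierStokesRegularity.Theses.EulerZoomLiouville
import Summits.NavierStokesRegularity.NavierStokesRegularity.Theorems.EulerZoomLiouvillePowerGaugeEulerLiouvilleSelfSimilarSwirlBudget
import Summits.NavierStokesRegularity.NavierStokesRegularity.Theorems.EulerZoomLiouvillePowerGaugeEulerLiouvilleNeedleHoveringPast
import Summits.NavierStokesRegularity.NavierStokesRegularity.Theorems.EulerZoomLiouvillePowerGaugeEulerLiouvilleSelfSimilarStrainExcessGrowth
import Summits.NavierStokesRegularity.NavierStokesRegularity.Theorems.EulerZoomLiouvillePowerGaugeEulerLiouvilleVirialForm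
import HarnessLib.Audit

/-!
# Line `needle_faces` — THE NEEDLE PARKS OR DIES (ideator ns-idea-11 g7, lens «complete» = program-completion)

Crux E `PowerGaugeEulerLiouville` (stmt-NavierStokesRegularity-19832), LEAD skeleton `Lines/birth.lean` v78
(ns-typeII-p2 g12), open stub `Birth.stub_selfSimilarC2Needle` (THE ONE STATEMENT).  This file is an OFFER to the
LEAD: by-name Props for the two author-named faces of the needle (RESIDUE-MEMO-19832-g12 §2/§4/§7: T1 «swirl without
symmetry», T2 «pressurised parked tubes — the missing capacity estimate») and a third, WEAKER structural statement
(«the needle parks»), with the three compositions into the needle KERNEL-CHECKED (pure logic, no new binder):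

* `Sig.stub_pressureFace`  (FACE B = T2): under the needle data, for every `ε > 0`, every classical pressure `P′` and
  every level `h`, far vortical Bernoulli-high points are UNPRESSURISED, `P′ y ≤ ε‖y‖²`.
* `Sig.stub_swirlFace`     (FACE A = T1 ∪ outflow): under the needle data, for one `ε > 0` and one rate
  `c₁ > 1/((2+ρ)(1+ρ))`, far vortical Bernoulli-high points with `P′ y ≤ ε‖y‖²` are `c₁`-FAST INFLOW points of the
  similarity wind `W = γy + V`.  (Arithmetic: a high, `ε`-unpressurised point has `‖W‖² > (γ(1−γ) − 2ε)‖y‖² + 2h`,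
  so a point that is not `c₁`-fast inflow is either SWIRLING — `‖W_tan‖² ≥ (γ(1−γ) − 2ε − c₁²)‖y‖² + 2h`, the
  symmetry-free T1 residue — or `c₁`-fast OUTFLOW.)
* `Sig.stub_needleParks`   (L, «THE NEEDLE PARKS»): under the needle data AND `¬ HasFastVorticalChannel`, some
  `ε > 0`, some classical pressure and some level admit PRESSURISED vortical high points `P′ y > ε‖y‖²` beyond every
  radius — the LEAD's structural reading (A2)(ii) («surviving slow channel points are parked at far near-stagnation
  points of `W`») as a statement.  PROVED here: `needleParks_of_swirlFace : A → L`; so `L` is the weaker target.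

Compositions (proved, no `sorry`): `selfSimilarC2Needle_of_parking : L → B → needle` (the line),
`selfSimilarC2Needle_of_faces : A → B → needle`, `needleParks_of_swirlFace : A → L`.
DENT on the crux: 0 (no stub of `birth.lean` is closed by this file; it types the residual programme).
REV 2 (idea-crit-8 V63 P1): + the SHARP PINCER at a fixed pressure level, `Sig.stub_needleStagnates` (L♯) /
`Sig.stub_stagnationMargin` (B♯), `selfSimilarC2Needle_of_stagnation : L♯ → B♯ → needle`, `L♯ → L`, `B → B♯` proved (see §REV 2 below).
REV 3: the landed flux law (F) `…Theorems.PowerGaugeEulerLiouville.HighSetFlux.*` and capacity layer (K) `…PressureParking.*` (ns-ezl-w1 g5)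
cited BY NAME in the B docstring (tools for B / B♯; not binders; decls unchanged).
REV 4 (21:45Z, after `Lines/birth.lean` v83 REGISTERED): `HasFastVorticalChannel` re-copied VERBATIM from v83 (threshold `0 < c₁` — «ANY FAST CHANNEL
KILLS», LEAD g13 `Loc.selfSimilar_ae_eq_zero_of_vorticalChannelC2_profile_anyRate`); the needle text is character-identical to v83; L / L♯ now read
with the STRONGER binder (weaker claims, same decl texts); `needleParks_of_swirlFace` bridged by `c₁ > 1/((2+ρ)(1+ρ)) ⇒ c₁ > 0`.  New tree tools
cited for L/L♯/B♯ (not binders): `OutflowDive.slowBand_of_not_channel` (ns-ezl-w3 g5 p669403: under ¬channel, RADIALLY-SLOW high vortical points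
beyond every radius = the parking candidates), `Ballistic.ridgeNeedsMomentumFlux` (ns-ezl-w2 g4 p668191: pressure ridges need momentum flux —
the radial-extent tool for pressurised cells), `HighSetFlux.volume_highSet_ball_le` (p667320, sphere form of the flux law).
REV 5 (22:20Z, `Lines/birth.lean` v85 in the tree): `HasFastVorticalChannel` re-copied VERBATIM from v85 = THREE killed senses (any-rate inflow channel ∨
inflow half-band deficit ∨ virial form); needle text + all copied predicates character-identical to v85 (script-checked); bridges now `Or.inl ⟨c₁, …⟩`
(resp. `fun h => hV (Or.inl h)` for the by-name corollaries); nothing else changed.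
REV 6 (22:45Z, `Lines/birth.lean` ★ v86 c942a8e28728 registered 22:33Z): `HasFastVorticalChannel` re-copied VERBATIM from v86 = FIVE killed senses; needle +
all copied predicates character-identical to v86 (script-checked); bridges unchanged (`Or.inl`); stub texts unchanged.
  + section `Residue` (CLOSED, class-free, 0 sorry): (R0) `Residue.inner_gradient_eq` ⟪y,∇P′⟫ = ‖W‖² + γ(1−γ)‖y‖² − (1−2γ)⟪y,W⟫ − a(y);
(R1) `pressure_gt_of_high_of_hovering` (hovering high point ⇒ stagnation-level pressure = L♯'s conclusion pointwise); (R1′) `speed_gt_of_high_of_pressure_le`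
(B♯'s ceiling at a high point ⇒ similarity speed² > 2h + 2δ‖y‖²: no hovering); (R2) `inner_gradient_gt_of_residue` (⟪y,W⟫ ≤ 0 ∧ a < a₀ ⇒
⟪y,∇P′⟫ > ‖W‖² + γ(1−γ)‖y‖² − a₀: the v86 residue climbs the pressure radially) — the typed kernel of the g8 brief «radial-reach squeeze» (card §REV 6).
REV 7 (g8, 23:06Z, `Lines/birth.lean` ★ v87 sha256:9ccebdd516bb in the tree, 2172 l.): `HasFastVorticalChannel` re-copied VERBATIM from v87 = SEVEN killed senses
(v86's five + (6) absolute virial form, ns-ezl-w1 g6 p674543 + (7) decaying floor `a ≥ a₀/‖y‖²`, LEAD g13); all other copied predicates untouched and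
character-identical to v87 (script `recopy_v87.py`); bridges unchanged (`Or.inl`); stub texts unchanged; no new mathematics in this revision.
REV 8 (g8, 23:30Z, `Lines/birth.lean` ★ v89 commit 7176ac66e19c sha16 83158934bc1e25e0, 2205 l.): `HasFastVorticalChannel` (NINE senses: + (8) absolute
radial-pressure form, ns-sfl-p1 g6; + (9) rpow power band, ns-ezl-w1 g6) AND `HasResidenceClock` (SIX alternatives: + (6) v88 LOCAL power clock, LEAD g13)
re-copied VERBATIM from v89 (script `recopy_v89.py`; all 9 shared predicates character-identical, `identity_check.py`); bridges unchanged (`Or.inl`); stub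
texts unchanged; no new mathematics in this revision.
No summit is proved by a line; the crux is OPEN; NS regularity is NOT proved.
-/

open MeasureTheory Set Filter Topology Metric
open scoped ENNReal NNReal ContDiff

set_option linter.dupNamespace false

namespace Summit.NavierStokesRegularity.NavierStokesRegularity.Cruxes.PowerGaugeEulerLiouville.NeedleFaces

/-- Local abbreviation: ℝ³ (verbatim `Birth.E3`). -/
abbrev E3 : Type := EuclideanSpace ℝ (Fin 3)

/-- Membership in Seregin's power-gauged ancient Euler class (verbatim `Birth.InClass`, `Lines/birth.lean` v78). -/
@[reducible] def InClass (ρ : ℝ) (u : ℝ → E3 → E3) (p : ℝ → E3 → ℝ) (H : ℝ → E3 → E3 →L[ℝ] E3)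
    (c : ℝ≥0) : Prop :=
  Literature.Analysis.FluidPDE.IsSuitableWeakSolutionOn
      (Literature.Analysis.FluidPDE.slab (EuclideanSpace ℝ (Fin 3)) (Set.Iio 0) isOpen_Iio) 0 0 u p ∧
    Literature.Analysis.FluidPDE.HasWeakSpatialGradientOn
      (Literature.Analysis.FluidPDE.slab (EuclideanSpace ℝ (Fin 3)) (Set.Iio 0) isOpen_Iio) u H ∧
    (∀ a : ℝ, 0 < a →
      ENNReal.ofReal (a ^ (2 * ρ)) * Literature.Analysis.FluidPDE.cknA a (0 : ℝ × E3) u +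
          ENNReal.ofReal (a ^ ρ) * Literature.Analysis.FluidPDE.cknE a (0 : ℝ × E3) H +
        ENNReal.ofReal (a ^ (2 * ρ)) * Literature.Analysis.FluidPDE.cknD a (0 : ℝ × E3) p ≤ (c : ℝ≥0∞))

/-- Exactly self-similar member about the origin with profile `(V, P)` (verbatim `Birth.IsExactlySelfSimilar`, v78). -/
@[reducible] def IsExactlySelfSimilar (ρ : ℝ) (u : ℝ → E3 → E3) (p : ℝ → E3 → ℝ) (V : E3 → E3) (P : E3 → ℝ) :
    Prop :=
  (∀ τ : ℝ, τ < 0 → u τ = Literature.Analysis.FluidPDE.selfSimilarCollapse (1 / (2 + ρ)) 0 V τ) ∧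
    (∀ τ : ℝ, τ < 0 → p τ = Literature.Analysis.FluidPDE.selfSimilarCollapsePressure (1 / (2 + ρ)) 0 P τ)

/-- EXTREMAL profile: the `A`-gauge rate is saturated (verbatim `Birth.IsExtremalProfile`, v78). -/
@[reducible] def IsExtremalProfile (ρ : ℝ) (V : E3 → E3) : Prop :=
  ∃ ε : ℝ, 0 < ε ∧ ∃ L₀ : ℝ, ∀ L : ℝ, L₀ ≤ L →
    ε ≤ L ^ (2 * ρ - 1) * ∫ y in Metric.ball (0 : E3) L, ‖V y‖ ^ 2

/-- Bernoulli piercing on spheres beyond every radius (verbatim `Birth.HasBernoulliPiercing`, v78). -/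
@[reducible] def HasBernoulliPiercing (ρ : ℝ) (V : E3 → E3) : Prop :=
  ∀ P' : E3 → ℝ, Literature.Analysis.FluidPDE.IsSelfSimilarEulerProfile (1 / (2 + ρ)) 0 V P' →
    ∀ h R₀ : ℝ, ∃ R : ℝ, R₀ ≤ R ∧ ∀ y : E3, ‖y‖ = R →
      inner ℝ y (V y) ≤ -(1 / (2 + ρ) * ‖y‖ ^ 2) →
        (Literature.Analysis.FluidPDE.curl V y = 0 ∨
          Literature.Analysis.FluidPDE.selfSimilarBernoulli (1 / (2 + ρ)) 0 V P' y < h)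

/-- FAST VORTICAL CHANNEL in one of NINE killed senses (verbatim `Birth.HasFastVorticalChannel`, ★ v89): (1) ONE-SIDED inflow channel at ANY rate
`c₁ > 0` (v83, LEAD g13 `…vorticalChannelC2_profile_anyRate`); (2) INFLOW HALF-BAND DEFICIT (v84, LEAD g13 `…inflowBandDeficitC2_profile`); (3) VIRIAL
FORM (v85, ns-ezl-w1 g6 `…virialDeficitC2_profile`); (4) ABSOLUTE INFLOW-BAND DEFICIT «any inward drift kills» (v86, LEAD g13 p674010
`…absBandDeficitC2_profile`, POWER clock); (5) the h-FREE RADIAL-PRESSURE FORM (v86, ns-sfl-p1 g6 `…radialPressureDeficitC2_profile`); (6) ABSOLUTE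
VIRIAL form of (4) (v87, ns-ezl-w1 g6 p674543 `…absVirialDeficitC2_profile`); (7) = (4) with the DECAYING floor `a ≥ a₀/‖y‖²` (v87, LEAD g13
`…decayingBandDeficitC2_profile`); (8) ABSOLUTE RADIAL-PRESSURE FORM (v89, ns-sfl-p1 g6 `…absRadialPressureDeficitC2_profile`); (9) rpow POWER BAND
`0 ≤ e₁ < ρ`, `0 ≤ e₂ < 2+ρ+e₁` (v89, ns-ezl-w1 g6 `…powerBandDeficitC2_profile`: the swirl face is circular to order `‖y‖^{−1−ρ+0}` and centripetally
balanced to order `‖y‖^{−2−2ρ+0}`). -/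
@[reducible] def HasFastVorticalChannel (ρ : ℝ) (V : E3 → E3) : Prop :=
  (∃ c₁ : ℝ, 0 < c₁ ∧
    ∀ P' : E3 → ℝ, Literature.Analysis.FluidPDE.IsSelfSimilarEulerProfile (1 / (2 + ρ)) 0 V P' →
      ∀ h : ℝ, ∃ R₀ : ℝ, ∀ y : E3, R₀ ≤ ‖y‖ → h < Literature.Analysis.FluidPDE.selfSimilarBernoulli (1 / (2 + ρ)) 0 V P' y →
        Literature.Analysis.FluidPDE.curl V y ≠ 0 →
          inner ℝ y (Literature.Analysis.FluidPDE.selfSimilarTransport (1 / (2 + ρ)) 0 V y) ≤ -(c₁ * ‖y‖ ^ 2)) ∨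
  (∃ c₁ μ : ℝ, 0 < c₁ ∧ 0 < μ ∧
    ∀ P' : E3 → ℝ, Literature.Analysis.FluidPDE.IsSelfSimilarEulerProfile (1 / (2 + ρ)) 0 V P' →
      ∀ h : ℝ, ∃ R₀ : ℝ, ∀ y : E3, R₀ ≤ ‖y‖ → h < Literature.Analysis.FluidPDE.selfSimilarBernoulli (1 / (2 + ρ)) 0 V P' y →
        Literature.Analysis.FluidPDE.curl V y ≠ 0 →
          -(c₁ * ‖y‖ ^ 2) ≤ inner ℝ y (Literature.Analysis.FluidPDE.selfSimilarTransport (1 / (2 + ρ)) 0 V y) →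
          inner ℝ y (Literature.Analysis.FluidPDE.selfSimilarTransport (1 / (2 + ρ)) 0 V y) ≤ 0 →
          (2 * c₁ ^ 2 + μ) * ‖y‖ ^ 2 ≤ ‖Literature.Analysis.FluidPDE.selfSimilarTransport (1 / (2 + ρ)) 0 V y‖ ^ 2 +
            (1 / (2 + ρ)) * inner ℝ y (Literature.Analysis.FluidPDE.selfSimilarTransport (1 / (2 + ρ)) 0 V y) +
            inner ℝ y (fderiv ℝ V y (Literature.Analysis.FluidPDE.selfSimilarTransport (1 / (2 + ρ)) 0 V y))) ∨
  (∃ c₁ μ : ℝ, 0 < c₁ ∧ 0 < μ ∧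
    ∀ P' : E3 → ℝ, Literature.Analysis.FluidPDE.IsSelfSimilarEulerProfile (1 / (2 + ρ)) 0 V P' →
      ∀ h : ℝ, ∃ R₀ : ℝ, ∀ y : E3, R₀ ≤ ‖y‖ → h < Literature.Analysis.FluidPDE.selfSimilarBernoulli (1 / (2 + ρ)) 0 V P' y →
        Literature.Analysis.FluidPDE.curl V y ≠ 0 →
          -(c₁ * ‖y‖ ^ 2) ≤ inner ℝ y (Literature.Analysis.FluidPDE.selfSimilarTransport (1 / (2 + ρ)) 0 V y) →
          inner ℝ y (Literature.Analysis.FluidPDE.selfSimilarTransport (1 / (2 + ρ)) 0 V y) ≤ 0 →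
          2 * P' y + inner ℝ y (gradient P' y) ≤ 2 * h + (2 * (1 / (2 + ρ)) * (1 - 1 / (2 + ρ)) - 2 * c₁ ^ 2 - μ) * ‖y‖ ^ 2) ∨
  (∃ κb a₀ : ℝ, 0 < κb ∧ 0 < a₀ ∧
    ∀ P' : E3 → ℝ, Literature.Analysis.FluidPDE.IsSelfSimilarEulerProfile (1 / (2 + ρ)) 0 V P' →
      ∀ h : ℝ, ∃ R₀ : ℝ, ∀ y : E3, R₀ ≤ ‖y‖ → h < Literature.Analysis.FluidPDE.selfSimilarBernoulli (1 / (2 + ρ)) 0 V P' y →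
        Literature.Analysis.FluidPDE.curl V y ≠ 0 →
          -κb ≤ inner ℝ y (Literature.Analysis.FluidPDE.selfSimilarTransport (1 / (2 + ρ)) 0 V y) →
          inner ℝ y (Literature.Analysis.FluidPDE.selfSimilarTransport (1 / (2 + ρ)) 0 V y) ≤ 0 →
          a₀ ≤ ‖Literature.Analysis.FluidPDE.selfSimilarTransport (1 / (2 + ρ)) 0 V y‖ ^ 2 +
            (1 / (2 + ρ)) * inner ℝ y (Literature.Analysis.FluidPDE.selfSimilarTransport (1 / (2 + ρ)) 0 V y) +
            inner ℝ y (fderiv ℝ V y (Literature.Analysis.FluidPDE.selfSimilarTransport (1 / (2 + ρ)) 0 V y))) ∨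
  (∃ c₁ μ : ℝ, 0 < c₁ ∧ 0 < μ ∧
    ∀ P' : E3 → ℝ, Literature.Analysis.FluidPDE.IsSelfSimilarEulerProfile (1 / (2 + ρ)) 0 V P' →
      ∀ h : ℝ, ∃ R₀ : ℝ, ∀ y : E3, R₀ ≤ ‖y‖ → h < Literature.Analysis.FluidPDE.selfSimilarBernoulli (1 / (2 + ρ)) 0 V P' y →
        Literature.Analysis.FluidPDE.curl V y ≠ 0 →
          -(c₁ * ‖y‖ ^ 2) ≤ inner ℝ y (Literature.Analysis.FluidPDE.selfSimilarTransport (1 / (2 + ρ)) 0 V y) →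
          inner ℝ y (Literature.Analysis.FluidPDE.selfSimilarTransport (1 / (2 + ρ)) 0 V y) ≤ 0 →
          inner ℝ y (gradient P' y) ≤ ‖Literature.Analysis.FluidPDE.selfSimilarTransport (1 / (2 + ρ)) 0 V y‖ ^ 2 +
            ((1 / (2 + ρ)) * (1 - 1 / (2 + ρ)) - 2 * c₁ ^ 2 - μ) * ‖y‖ ^ 2) ∨
  (∃ κb a₀ : ℝ, 0 < κb ∧ 0 < a₀ ∧
    ∀ P' : E3 → ℝ, Literature.Analysis.FluidPDE.IsSelfSimilarEulerProfile (1 / (2 + ρ)) 0 V P' →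
      ∀ h : ℝ, ∃ R₀ : ℝ, ∀ y : E3, R₀ ≤ ‖y‖ → h < Literature.Analysis.FluidPDE.selfSimilarBernoulli (1 / (2 + ρ)) 0 V P' y →
        Literature.Analysis.FluidPDE.curl V y ≠ 0 →
          -κb ≤ inner ℝ y (Literature.Analysis.FluidPDE.selfSimilarTransport (1 / (2 + ρ)) 0 V y) →
          inner ℝ y (Literature.Analysis.FluidPDE.selfSimilarTransport (1 / (2 + ρ)) 0 V y) ≤ 0 →
          2 * P' y + inner ℝ y (gradient P' y) ≤ 2 * h + 2 * (1 / (2 + ρ)) * (1 - 1 / (2 + ρ)) * ‖y‖ ^ 2 - a₀) ∨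
  (∃ κb a₀ : ℝ, 0 < κb ∧ 0 < a₀ ∧
    ∀ P' : E3 → ℝ, Literature.Analysis.FluidPDE.IsSelfSimilarEulerProfile (1 / (2 + ρ)) 0 V P' →
      ∀ h : ℝ, ∃ R₀ : ℝ, ∀ y : E3, R₀ ≤ ‖y‖ → h < Literature.Analysis.FluidPDE.selfSimilarBernoulli (1 / (2 + ρ)) 0 V P' y →
        Literature.Analysis.FluidPDE.curl V y ≠ 0 →
          -κb ≤ inner ℝ y (Literature.Analysis.FluidPDE.selfSimilarTransport (1 / (2 + ρ)) 0 V y) →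
          inner ℝ y (Literature.Analysis.FluidPDE.selfSimilarTransport (1 / (2 + ρ)) 0 V y) ≤ 0 →
          a₀ / ‖y‖ ^ 2 ≤ ‖Literature.Analysis.FluidPDE.selfSimilarTransport (1 / (2 + ρ)) 0 V y‖ ^ 2 +
            (1 / (2 + ρ)) * inner ℝ y (Literature.Analysis.FluidPDE.selfSimilarTransport (1 / (2 + ρ)) 0 V y) +
            inner ℝ y (fderiv ℝ V y (Literature.Analysis.FluidPDE.selfSimilarTransport (1 / (2 + ρ)) 0 V y))) ∨
  (∃ κb a₀ : ℝ, 0 < κb ∧ 0 < a₀ ∧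
    ∀ P' : E3 → ℝ, Literature.Analysis.FluidPDE.IsSelfSimilarEulerProfile (1 / (2 + ρ)) 0 V P' →
      ∀ h : ℝ, ∃ R₀ : ℝ, ∀ y : E3, R₀ ≤ ‖y‖ → h < Literature.Analysis.FluidPDE.selfSimilarBernoulli (1 / (2 + ρ)) 0 V P' y →
        Literature.Analysis.FluidPDE.curl V y ≠ 0 →
          -κb ≤ inner ℝ y (Literature.Analysis.FluidPDE.selfSimilarTransport (1 / (2 + ρ)) 0 V y) → inner ℝ y (Literature.Analysis.FluidPDE.selfSimilarTransport (1 / (2 + ρ)) 0 V y) ≤ 0 →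
          inner ℝ y (gradient P' y) ≤ ‖Literature.Analysis.FluidPDE.selfSimilarTransport (1 / (2 + ρ)) 0 V y‖ ^ 2 +
            (1 / (2 + ρ)) * (1 - 1 / (2 + ρ)) * ‖y‖ ^ 2 - a₀) ∨
  (∃ κb a₀ e₁ e₂ : ℝ, 0 < κb ∧ 0 < a₀ ∧ 0 ≤ e₁ ∧ e₁ < ρ ∧ 0 ≤ e₂ ∧ e₂ < 2 + ρ + e₁ ∧
    ∀ P' : E3 → ℝ, Literature.Analysis.FluidPDE.IsSelfSimilarEulerProfile (1 / (2 + ρ)) 0 V P' →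
      ∀ h : ℝ, ∃ R₀ : ℝ, ∀ y : E3, R₀ ≤ ‖y‖ → h < Literature.Analysis.FluidPDE.selfSimilarBernoulli (1 / (2 + ρ)) 0 V P' y →
        Literature.Analysis.FluidPDE.curl V y ≠ 0 →
          -(κb * ‖y‖ ^ (-e₁)) ≤ inner ℝ y (Literature.Analysis.FluidPDE.selfSimilarTransport (1 / (2 + ρ)) 0 V y) → inner ℝ y (Literature.Analysis.FluidPDE.selfSimilarTransport (1 / (2 + ρ)) 0 V y) ≤ 0 →
          a₀ * ‖y‖ ^ (-e₂) ≤ ‖Literature.Analysis.FluidPDE.selfSimilarTransport (1 / (2 + ρ)) 0 V y‖ ^ 2 +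
            (1 / (2 + ρ)) * inner ℝ y (Literature.Analysis.FluidPDE.selfSimilarTransport (1 / (2 + ρ)) 0 V y) +
            inner ℝ y (fderiv ℝ V y (Literature.Analysis.FluidPDE.selfSimilarTransport (1 / (2 + ρ)) 0 V y)))

/-- Residence clock, SIX alternatives (verbatim `Birth.HasResidenceClock`, ★ v88/v89): (1) LOG clock, (2) POWER clock `c′R^{2+ρ}`, (3)/(4) subcritical
strain clocks, (5) the HOVERING LAW with Bernoulli oscillation exponent `θ_ℋ < 2+ρ`, (6) v88 LOCAL power clock — for every `c′ > 0` ONE ball, centre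
arbitrary (LEAD g13 `NeedleRace.selfSimilar_ae_eq_zero_of_localPowerClockC2`). -/
@[reducible] def HasResidenceClock (ρ : ℝ) (V : E3 → E3) : Prop :=
  (∃ s₁ : ℝ, 0 ≤ s₁ ∧ ∀ x₀ : E3, Literature.Analysis.FluidPDE.curl V x₀ ≠ 0 → ∃ r : ℝ, 0 < r ∧ ∃ R₀ : ℝ, ∀ R : ℝ, R₀ ≤ R →
      ∀ (V' : E3 → E3) (K Rbig : ℝ), ContDiff ℝ 2 V' → (∀ y, ‖fderiv ℝ V' y‖ ≤ K) → 2 * R < Rbig →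
        (∀ w ∈ Metric.ball (0 : E3) Rbig, V' w = V w) →
        (volume (Metric.ball x₀ r ∩ {y | ∀ σ ∈ Set.Icc 0 (s₁ * Real.log R),
          ‖Literature.Analysis.ODE.evolutionMap (fun _ : ℝ => Literature.Analysis.FluidPDE.selfSimilarTransport (1 / (2 + ρ)) 0 V') 0 (-σ) y‖ ≤ 2 * R})).toReal ≤
          (volume (Metric.ball x₀ r)).toReal / 2) ∨
  (∀ c' : ℝ, 0 < c' → ∀ x₀ : E3, Literature.Analysis.FluidPDE.curl V x₀ ≠ 0 → ∃ r : ℝ, 0 < r ∧ ∃ R₀ : ℝ, ∀ R : ℝ, R₀ ≤ R →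
      ∀ (V' : E3 → E3) (K Rbig : ℝ), ContDiff ℝ 2 V' → (∀ y, ‖fderiv ℝ V' y‖ ≤ K) → 2 * R < Rbig →
        (∀ w ∈ Metric.ball (0 : E3) Rbig, V' w = V w) →
        (volume (Metric.ball x₀ r ∩ {y | ∀ σ ∈ Set.Icc 0 (c' * R ^ (2 + ρ)),
          ‖Literature.Analysis.ODE.evolutionMap (fun _ : ℝ => Literature.Analysis.FluidPDE.selfSimilarTransport (1 / (2 + ρ)) 0 V') 0 (-σ) y‖ ≤ 2 * R})).toReal ≤
          (volume (Metric.ball x₀ r)).toReal / 2) ∨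
  (∃ s : ℝ, s < 1 ∧ (∀ z v : E3, inner ℝ (fderiv ℝ V z v) v ≤ s * ‖v‖ ^ 2) ∧
    ∀ ε : ℝ, 0 < ε → ∃ R₂ : ℝ, ∀ z : E3, R₂ ≤ ‖z‖ → Real.log ‖Literature.Analysis.FluidPDE.curl V z‖ ≤ ε * ‖z‖ ^ (2 + ρ)) ∨
  (∃ s : ℝ, s < (1 + 2 * ρ) / (2 * (2 + ρ)) ∧ ∀ z v : E3, inner ℝ (fderiv ℝ V z v) v ≤ s * ‖v‖ ^ 2) ∨
  (∃ θ : ℝ, θ < 2 + ρ ∧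
    (∀ P' : E3 → ℝ, Literature.Analysis.FluidPDE.IsSelfSimilarEulerProfile (1 / (2 + ρ)) 0 V P' →
      ∃ C : ℝ, ∀ r : ℝ, 1 ≤ r → ∀ y y' : E3, ‖y‖ ≤ r → ‖y'‖ ≤ r →
        Literature.Analysis.FluidPDE.selfSimilarBernoulli (1 / (2 + ρ)) 0 V P' y - Literature.Analysis.FluidPDE.selfSimilarBernoulli (1 / (2 + ρ)) 0 V P' y' ≤ C * r ^ θ) ∧
    ∀ c' : ℝ, 0 < c' → ∀ x₀ : E3, Literature.Analysis.FluidPDE.curl V x₀ ≠ 0 → ∃ r : ℝ, 0 < r ∧ ∃ R₀ : ℝ,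
      ∀ R : ℝ, R₀ ≤ R → ∀ (V' : E3 → E3) (K Rbig : ℝ), ContDiff ℝ 2 V' →
        (∀ y, ‖fderiv ℝ V' y‖ ≤ K) → 2 * R < Rbig → (∀ w ∈ Metric.ball (0 : E3) Rbig, V' w = V w) →
        (volume (Metric.ball x₀ r ∩ {a | ∀ σ ∈ Set.Icc 0 (c' * R ^ (2 + ρ)), ‖Literature.Analysis.ODE.evolutionMap (fun _ : ℝ => Literature.Analysis.FluidPDE.selfSimilarTransport (1 / (2 + ρ)) 0 V') 0 (-σ) a‖ ≤ 2 * R} ∩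
          {a | c' * R ^ (2 + ρ) / 2 ≤ (volume {σ ∈ Set.Icc 0 (c' * R ^ (2 + ρ)) |
            ‖Literature.Analysis.FluidPDE.selfSimilarTransport (1 / (2 + ρ)) 0 V' (Literature.Analysis.ODE.evolutionMap (fun _ : ℝ => Literature.Analysis.FluidPDE.selfSimilarTransport (1 / (2 + ρ)) 0 V') 0 (-σ) a)‖ < R ^ (-((2 + ρ - θ) / 4))}).toReal})).toReal ≤
          (volume (Metric.ball x₀ r)).toReal / 4) ∨
  (∀ c' : ℝ, 0 < c' → ∃ x₀ : E3, ∃ r : ℝ, 0 < r ∧ ∃ R₀ : ℝ, ∀ R : ℝ, R₀ ≤ R →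
      ∀ (V' : E3 → E3) (K Rbig : ℝ), ContDiff ℝ 2 V' → (∀ y, ‖fderiv ℝ V' y‖ ≤ K) → 2 * R < Rbig →
        (∀ w ∈ Metric.ball (0 : E3) Rbig, V' w = V w) →
        (volume (Metric.ball x₀ r ∩ {y | ∀ σ ∈ Set.Icc 0 (c' * R ^ (2 + ρ)),
          ‖Literature.Analysis.ODE.evolutionMap (fun _ : ℝ => Literature.Analysis.FluidPDE.selfSimilarTransport (1 / (2 + ρ)) 0 V') 0 (-σ) y‖ ≤ 2 * R})).toReal ≤
          (volume (Metric.ball x₀ r)).toReal / 2)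

/-- Bounded vortical Bernoulli levels + unpressurised vortical far field (verbatim `Birth.HasVorticalBernoulliBound`, v52/v78). -/
@[reducible] def HasVorticalBernoulliBound (ρ : ℝ) (V : E3 → E3) : Prop :=
  ∀ P' : E3 → ℝ, Literature.Analysis.FluidPDE.IsSelfSimilarEulerProfile (1 / (2 + ρ)) 0 V P' →
    (∃ Mb : ℝ, ∀ y : E3, Literature.Analysis.FluidPDE.curl V y ≠ 0 →
        Literature.Analysis.FluidPDE.selfSimilarBernoulli (1 / (2 + ρ)) 0 V P' y ≤ Mb) ∧
    (∃ ε R₀ : ℝ, ε < (1 / (2 + ρ)) * (1 - 1 / (2 + ρ)) / 2 ∧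
        ∀ y : E3, R₀ ≤ ‖y‖ → Literature.Analysis.FluidPDE.curl V y ≠ 0 → P' y ≤ ε * ‖y‖ ^ 2)

/-- Tame vortical Bernoulli levels, growth form (verbatim `Birth.HasTameVorticalBernoulli`, v78). -/
@[reducible] def HasTameVorticalBernoulli (ρ : ℝ) (V : E3 → E3) : Prop :=
  HasVorticalBernoulliBound ρ V ∨
    ((∀ P' : E3 → ℝ, Literature.Analysis.FluidPDE.IsSelfSimilarEulerProfile (1 / (2 + ρ)) 0 V P' →
        ∃ Mb : ℝ, ∀ y : E3, Literature.Analysis.FluidPDE.curl V y ≠ 0 → Literature.Analysis.FluidPDE.selfSimilarBernoulli (1 / (2 + ρ)) 0 V P' y ≤ Mb) ∧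
      (∃ A q R₀ : ℝ, 0 ≤ A ∧ 0 ≤ q ∧ q < 2 + 2 * (1 + 2 * ρ) / 3 ∧
        ∀ z : E3, R₀ ≤ ‖z‖ → Literature.Analysis.FluidPDE.frobeniusNormSq (fderiv ℝ V z) - ‖Literature.Analysis.FluidPDE.curl V z‖ ^ 2 ≤ A * ‖z‖ ^ q))

/-- THE ONE STATEMENT — verbatim `Birth.Sig.stub_selfSimilarC2Needle` (`Lines/birth.lean` v78, open stub of the LEAD skeleton); over the verbatim predicate copies above it is definitionally the LEAD's needle (`Iff.rfl` once both files are in scope). -/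
def Sig.stub_selfSimilarC2Needle : Prop :=
  ∀ ρ : ℝ, 0 < ρ → ρ ≤ 1 / 2 →
    ∀ (u : ℝ → E3 → E3) (p : ℝ → E3 → ℝ) (H : ℝ → E3 → E3 →L[ℝ] E3) (c : ℝ≥0) (V : E3 → E3) (P : E3 → ℝ),
      InClass ρ u p H c → IsExactlySelfSimilar ρ u p V P → IsExtremalProfile ρ V → ContDiff ℝ 2 V →
        ¬ HasBernoulliPiercing ρ V → ¬ HasTameVorticalBernoulli ρ V → ¬ HasFastVorticalChannel ρ V → ¬ HasResidenceClock ρ V →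
        ¬ (∃ R : E3 ≃ₗᵢ[ℝ] E3, Literature.Analysis.FluidPDE.IsAxisymmetric (fun y => R (V (R.symm y)))) →
        Function.uncurry u =ᵐ[volume.restrict (Set.Iio (0 : ℝ) ×ˢ (Set.univ : Set E3))] 0


/-- THE NEEDLE DATA: every hypothesis of `Birth.Sig.stub_selfSimilarC2Needle` EXCEPT the channel binder
`¬ HasFastVorticalChannel ρ V`, bundled (verbatim predicates of `Lines/birth.lean` v78). -/
@[reducible] def NeedleData (ρ : ℝ) (u : ℝ → E3 → E3) (p : ℝ → E3 → ℝ) (H : ℝ → E3 → E3 →L[ℝ] E3)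
    (c : ℝ≥0) (V : E3 → E3) (P : E3 → ℝ) : Prop :=
  InClass ρ u p H c ∧ IsExactlySelfSimilar ρ u p V P ∧ IsExtremalProfile ρ V ∧ ContDiff ℝ 2 V ∧
    ¬ HasBernoulliPiercing ρ V ∧ ¬ HasTameVorticalBernoulli ρ V ∧ ¬ HasResidenceClock ρ V ∧
    ¬ (∃ R : E3 ≃ₗᵢ[ℝ] E3, Literature.Analysis.FluidPDE.IsAxisymmetric (fun y => R (V (R.symm y))))

/-- Signature of `stub_pressureFace` (FACE B = T2, OPEN): under the needle data, for EVERY `ε > 0`, every classical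
pressure `P′` of `V` and every level `h` there is `R₀` beyond which every VORTICAL point of `{ℋ_{P′} > h}` is
unpressurised: `P′ y ≤ ε‖y‖²`.  Informal: the pressurised parked tubes of RESIDUE-MEMO §2 T2 (`P′ ≈ ½γ(1−γ)R²`,
`W ≈ 0`, cross-section `≲ R^{−4−3ρ}`) do not exist far out — the «transverse-balance / capacity estimate» the LEAD
names as missing (ns-ezl-w1 g4/g5 HANDOFF: four leads).  Why it might fail: a hot cell of diameter `R^{−1−ρ}` fed by a
jet is locally budget-consistent (enstrophy cost `R^{1−ρ}/log R` per cell, W8 D2-FEASIBILITY); the kill must be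
global (flux of the high set, `Loc.volume_exitSet_mul_le`, or harmonic sub-mean-value + `D`-budget along the feeding jet).
REV 3 — LANDED TOOLS, CITE BY NAME (ns-ezl-w1 g5, both `--supports stmt-NavierStokesRegularity-19832 --as helper`):
(F) «JETS MUST TURN», the high-set flux law — `Summit.NavierStokesRegularity.NavierStokesRegularity.Theorems.PowerGaugeEulerLiouville.HighSetFlux.flux_turning_law`,
`.bernoulli_flux_turning_law`, `.flux_integrand_eq`, `.setIntegral_closedBall_sq_norm_le_of_gauge`, `.tendsto_volume_inter_far_zero`
(`Theorems/EulerZoomLiouvillePowerGaugeEulerLiouvilleSelfSimilarHighSetFlux{Tools}.lean`, p661937/p662342): for every level `h` with far high set of finite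
volume, every `η > 0` and layer `0 < r ≤ R`, INFLOW flux of `{ℋ > h}` through the layer ≤ OUTFLOW flux + `3γ·vol({ℋ > h} ∩ far)`;
(K) the CAPACITY LAYER of the pressurised set — `…Theorems.PowerGaugeEulerLiouville.PressureParking.pressure_excess_le_potential`
(`P′ x₀ ≤ ⨍χ_R P′(x₀ + ·) + (12/m) ∫_{B_{2R}(x₀)} ‖DV‖²‖z − x₀‖⁻¹`), `.measure_pressurised_le_of_potential_le` (dual capacity bound
`κL²·ν(S) ≤ (12/m)·Θ·c_E(3L)^{1−ρ}`), `.volume_pressurised_le` / `_rpow` (`vol S ≲ (c_E/κ)³ L^{−3−3ρ}`), `.defect_le_potential`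
(`Theorems/…SelfSimilarPressureCapacity{Kernel}.lean`).  HONEST READING (ezl-w1): with class data used statically the capacity bound is all
the geometry one gets (a radial segment has capacity 0), so B needs (F) + (K) TOGETHER along the feeding jet, or dynamics at the core scale. -/
def Sig.stub_pressureFace : Prop :=
  ∀ ρ : ℝ, 0 < ρ → ρ ≤ 1 / 2 →
    ∀ (u : ℝ → E3 → E3) (p : ℝ → E3 → ℝ) (H : ℝ → E3 → E3 →L[ℝ] E3) (c : ℝ≥0) (V : E3 → E3) (P : E3 → ℝ),
      NeedleData ρ u p H c V P →
        ∀ ε : ℝ, 0 < ε →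
          ∀ P' : E3 → ℝ, Literature.Analysis.FluidPDE.IsSelfSimilarEulerProfile (1 / (2 + ρ)) 0 V P' →
            ∀ h : ℝ, ∃ R₀ : ℝ, ∀ y : E3, R₀ ≤ ‖y‖ →
              h < Literature.Analysis.FluidPDE.selfSimilarBernoulli (1 / (2 + ρ)) 0 V P' y →
                Literature.Analysis.FluidPDE.curl V y ≠ 0 → P' y ≤ ε * ‖y‖ ^ 2

/-- Signature of `stub_swirlFace` (FACE A = T1 ∪ outflow, OPEN, symmetry-free): under the needle data there are ONE
`ε > 0` and ONE rate `c₁ > 1/((2+ρ)(1+ρ))` such that, for every classical pressure `P′` and level `h`, beyond some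
`R₀` every vortical point of `{ℋ_{P′} > h}` with `P′ y ≤ ε‖y‖²` is a `c₁`-fast inflow point: `⟪y, γy + V y⟫ ≤ −c₁‖y‖²`.
Informal: ε-unpressurised slow high points are SWIRLING (`‖W_tan‖² ≥ (γ(1−γ) − 2ε − c₁²)‖y‖² + 2h`) or fast OUTFLOW;
neither survives far out.  This is RESIDUE-MEMO §2 T1 WITHOUT an axis of symmetry (the v76 binder only removes
axisymmetric profiles; ns-ezl-w3 g4 FINAL: «T1 without symmetry not reached»).  Why it might fail: thin spiral jets
with pitch `s̄ ∈ (1−γ, γ/(1−γ))` (non-empty for `ρ ≤ ½`) are budget- and Bernoulli-consistent at the order-of-magnitude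
level (this seat's log-spike anatomy, `Lines/needle_faces.md` §Barriers); the similarity friction `(1−2γ)‖W‖²` only
makes swirl episodes TRANSIENT (≤ O((K+γ)²) radians per dyadic shell under linear growth), not absent. -/
def Sig.stub_swirlFace : Prop :=
  ∀ ρ : ℝ, 0 < ρ → ρ ≤ 1 / 2 →
    ∀ (u : ℝ → E3 → E3) (p : ℝ → E3 → ℝ) (H : ℝ → E3 → E3 →L[ℝ] E3) (c : ℝ≥0) (V : E3 → E3) (P : E3 → ℝ),
      NeedleData ρ u p H c V P →
        ∃ ε : ℝ, 0 < ε ∧ ∃ c₁ : ℝ, 1 / ((2 + ρ) * (1 + ρ)) < c₁ ∧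
          ∀ P' : E3 → ℝ, Literature.Analysis.FluidPDE.IsSelfSimilarEulerProfile (1 / (2 + ρ)) 0 V P' →
            ∀ h : ℝ, ∃ R₀ : ℝ, ∀ y : E3, R₀ ≤ ‖y‖ →
              h < Literature.Analysis.FluidPDE.selfSimilarBernoulli (1 / (2 + ρ)) 0 V P' y →
                Literature.Analysis.FluidPDE.curl V y ≠ 0 → P' y ≤ ε * ‖y‖ ^ 2 →
                  inner ℝ y (Literature.Analysis.FluidPDE.selfSimilarTransport (1 / (2 + ρ)) 0 V y) ≤ -(c₁ * ‖y‖ ^ 2)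

/-- Signature of `stub_needleParks` («THE NEEDLE PARKS», OPEN; weaker than `stub_swirlFace`, see
`needleParks_of_swirlFace`): under the needle data and `¬ HasFastVorticalChannel ρ V` (so: slow vortical high points
beyond every radius, for every admissible rate), SOME `ε > 0`, SOME classical pressure `P′` and SOME level `h` admit,
beyond every radius, a vortical point of `{ℋ_{P′} > h}` that is PRESSURISED: `ε‖y‖² < P′ y`.  Informal: a needle that
is nowhere `c₁`-fast cannot keep all its slow points unpressurised — transient swirl/outflow episodes must end at parked,
pressurised near-stagnation cells of `W` (LEAD (A1) p641204 «fast io. + ¬channel ⇒ lingering», (A2) p641271 «long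
tangential lingering ⇒ pressurised points» under linear growth; the gap is the TRANSIENT swirl episode and the growth
hypothesis).  Why it might fail: without a growth bound on the high set the head pump `(1−2γ)‖W‖²` converts lingering into
speed, not pressure; a needle whose slow points are all brief super-fast swirl flashes would have no pressurised points. -/
def Sig.stub_needleParks : Prop :=
  ∀ ρ : ℝ, 0 < ρ → ρ ≤ 1 / 2 →
    ∀ (u : ℝ → E3 → E3) (p : ℝ → E3 → ℝ) (H : ℝ → E3 → E3 →L[ℝ] E3) (c : ℝ≥0) (V : E3 → E3) (P : E3 → ℝ),
      NeedleData ρ u p H c V P → ¬ HasFastVorticalChannel ρ V →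
        ∃ ε : ℝ, 0 < ε ∧
          ∃ P' : E3 → ℝ, Literature.Analysis.FluidPDE.IsSelfSimilarEulerProfile (1 / (2 + ρ)) 0 V P' ∧
            ∃ h : ℝ, ∀ R₀ : ℝ, ∃ y : E3, R₀ ≤ ‖y‖ ∧
              h < Literature.Analysis.FluidPDE.selfSimilarBernoulli (1 / (2 + ρ)) 0 V P' y ∧
                Literature.Analysis.FluidPDE.curl V y ≠ 0 ∧ ε * ‖y‖ ^ 2 < P' y

/-! ## Residue calculus (REV 6, g7 — CLOSED, class-free; the typed kernel of the g8 brief)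

After `Lines/birth.lean` v86 the LEAD's needle residue is: beyond every radius, vortical Bernoulli-high points with `−κb ≤ ⟪y, W y⟫ ≤ 0`
(circular to order `1/‖y‖`) and radial acceleration `a(y) = ‖W‖² + γ⟪y,W⟫ + ⟪y, DV(y)W⟫ < a₀` (centripetally balanced), for all
`κb, a₀ > 0`.  The four lemmas below place faces L♯/B♯ against it: a HOVERING residue point (‖W‖² ≤ 2η‖y‖²) carries stagnation-level
pressure (R1 — L♯'s conclusion pointwise); under B♯'s ceiling every far high vortical point is FAST (R1′), and a fast balanced
inflow point climbs the pressure radially at rate `> (γ(1−γ) + 2δ)‖y‖² + 2h − a₀` (R2 + R1′) against a ceiling growing like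
`(½γ(1−γ) − δ)‖y‖²` — so residue points cannot fill long radial segments of the far high vortical set («radial-reach squeeze»;
what is missing for a kill is a similarity-speed ceiling ‖W y‖ ≲ ‖y‖ or a lower pressure bound at the inner end: g8). -/

namespace Residue

open Literature.Analysis Literature.Analysis.FluidPDE
open scoped RealInnerProductSpace

variable {γ : ℝ} {V : EuclideanSpace ℝ (Fin 3) → EuclideanSpace ℝ (Fin 3)} {P : EuclideanSpace ℝ (Fin 3) → ℝ}

/-- (R0) THE RADIAL PRESSURE GRADIENT IDENTITY (class-free, `h`-free, `P`-value-free): for every classical profile,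
`⟪y, ∇P(y)⟫ = ‖W y‖² + γ(1−γ)‖y‖² − (1−2γ)⟪y, W y⟫ − a(y)` with `a = ‖W‖² + γ⟪y,W⟫ + ⟪y, DV(y) W⟫` the radial acceleration —
`VirialForm.radialAcceleration_eq` minus twice the unfolded Bernoulli function. -/
theorem inner_gradient_eq (hprof : IsSelfSimilarEulerProfile γ 0 V P) (y : EuclideanSpace ℝ (Fin 3)) :
    ⟪y, gradient P y⟫ =
      ‖selfSimilarTransport γ 0 V y‖ ^ 2 + γ * (1 - γ) * ‖y‖ ^ 2 - (1 - 2 * γ) * ⟪y, selfSimilarTransport γ 0 V y⟫ -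
        (‖selfSimilarTransport γ 0 V y‖ ^ 2 + γ * ⟪y, selfSimilarTransport γ 0 V y⟫ +
          ⟪y, fderiv ℝ V y (selfSimilarTransport γ 0 V y)⟫) := by
  have h1 := Theorems.PowerGaugeEulerLiouville.VirialForm.radialAcceleration_eq hprof y
  have h2 : selfSimilarBernoulli γ 0 V P y =
      1 / 2 * ‖selfSimilarTransport γ 0 V y‖ ^ 2 + P y + γ * (γ - 1) / 2 * ‖y‖ ^ 2 := by
    simp [selfSimilarBernoulli_apply, selfSimilarTransport_apply]
  linarith

/-- (R1) HOVERING ⇒ STAGNATION-LEVEL PRESSURE (definitional, class-free): at a Bernoulli-high point whose similarity speed is small,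
`‖W y‖² ≤ 2η‖y‖²`, the pressure is at stagnation level: `P y > h + (½γ(1−γ) − η)‖y‖²`.  (Face L♯ ⇐ the HOVERING branch of the residue.) -/
theorem pressure_gt_of_high_of_hovering {η h : ℝ} {y : EuclideanSpace ℝ (Fin 3)}
    (hh : h < selfSimilarBernoulli γ 0 V P y) (hW : ‖selfSimilarTransport γ 0 V y‖ ^ 2 ≤ 2 * η * ‖y‖ ^ 2) :
    h + (1 / 2 * γ * (1 - γ) - η) * ‖y‖ ^ 2 < P y := by
  have h2 : selfSimilarBernoulli γ 0 V P y =
      1 / 2 * ‖selfSimilarTransport γ 0 V y‖ ^ 2 + P y + γ * (γ - 1) / 2 * ‖y‖ ^ 2 := by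
    simp [selfSimilarBernoulli_apply, selfSimilarTransport_apply]
  nlinarith

/-- (R1′) conversely, SUB-STAGNATION PRESSURE ⇒ FAST (definitional): at a Bernoulli-high point with `P y ≤ (½γ(1−γ) − δ)‖y‖²` the similarity
speed is large: `‖W y‖² > 2h + 2δ‖y‖²`.  (Under face B♯ every far high vortical point MOVES at similarity speed ≳ √(2δ)‖y‖: no hovering.) -/
theorem speed_gt_of_high_of_pressure_le {δ h : ℝ} {y : EuclideanSpace ℝ (Fin 3)}
    (hh : h < selfSimilarBernoulli γ 0 V P y) (hP : P y ≤ (1 / 2 * γ * (1 - γ) - δ) * ‖y‖ ^ 2) :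
    2 * h + 2 * δ * ‖y‖ ^ 2 < ‖selfSimilarTransport γ 0 V y‖ ^ 2 := by
  have h2 : selfSimilarBernoulli γ 0 V P y =
      1 / 2 * ‖selfSimilarTransport γ 0 V y‖ ^ 2 + P y + γ * (γ - 1) / 2 * ‖y‖ ^ 2 := by
    simp [selfSimilarBernoulli_apply, selfSimilarTransport_apply]
  nlinarith

/-- (R2) CENTRIPETALLY BALANCED INFLOW/CIRCULAR POINTS HAVE A STEEP OUTWARD PRESSURE GRADIENT (class-free, `h`-free): for `γ ≤ ½`, at a point
with `⟪y, W y⟫ ≤ 0` and radial acceleration `a(y) < a₀`, `⟪y, ∇P(y)⟫ > ‖W y‖² + γ(1−γ)‖y‖² − a₀`.  (The v86 residue of the LEAD's needle —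
near-circular, centripetally balanced far high vortical points — sits where the pressure climbs radially at rate ≳ γ(1−γ)‖y‖; against the
quadratic CEILING of faces B/B♯ this forbids long radial segments of residue: the «radial-reach squeeze», g8 brief in the card.) -/
theorem inner_gradient_gt_of_residue (hprof : IsSelfSimilarEulerProfile γ 0 V P) (hγ : γ ≤ 1 / 2) {a₀ : ℝ}
    {y : EuclideanSpace ℝ (Fin 3)} (hR : ⟪y, selfSimilarTransport γ 0 V y⟫ ≤ 0)
    (ha : ‖selfSimilarTransport γ 0 V y‖ ^ 2 + γ * ⟪y, selfSimilarTransport γ 0 V y⟫ +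
          ⟪y, fderiv ℝ V y (selfSimilarTransport γ 0 V y)⟫ < a₀) :
    ‖selfSimilarTransport γ 0 V y‖ ^ 2 + γ * (1 - γ) * ‖y‖ ^ 2 - a₀ < ⟪y, gradient P y⟫ := by
  have h0 := inner_gradient_eq hprof y
  have h3 : (1 - 2 * γ) * ⟪y, selfSimilarTransport γ 0 V y⟫ ≤ 0 := mul_nonpos_iff.mpr (Or.inl ⟨by linarith, hR⟩)
  linarith

end Residue

/-- FACE B (T2): OPEN. -/
theorem stub_pressureFace : Sig.stub_pressureFace := by
  sorry

/-- FACE A (T1 ∪ outflow, symmetry-free): OPEN. -/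
theorem stub_swirlFace : Sig.stub_swirlFace := by
  sorry

/-- «THE NEEDLE PARKS»: OPEN (implied by `stub_swirlFace`, see `needleParks_of_swirlFace`). -/
theorem stub_needleParks : Sig.stub_needleParks := by
  sorry

/-- FACE A implies «THE NEEDLE PARKS» (pure logic: the slow points that `¬ HasFastVorticalChannel` provides at the rate
`c₁` of face A cannot be `ε`-unpressurised, so they are pressurised). -/
theorem needleParks_of_swirlFace (hA : Sig.stub_swirlFace) : Sig.stub_needleParks := by
  intro ρ hρ hρ' u p H c V P hD hnch
  obtain ⟨ε, hε, c₁, hc₁, hAc⟩ := hA ρ hρ hρ' u p H c V P hD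
  by_contra hcon
  apply hnch
  refine Or.inl ⟨c₁, lt_trans (by positivity) hc₁, fun P' hP' h => ?_⟩
  obtain ⟨R₁, hR₁⟩ := hAc P' hP' h
  have hfar : ∃ R₀ : ℝ, ∀ y : E3, R₀ ≤ ‖y‖ →
      h < Literature.Analysis.FluidPDE.selfSimilarBernoulli (1 / (2 + ρ)) 0 V P' y →
        Literature.Analysis.FluidPDE.curl V y ≠ 0 → P' y ≤ ε * ‖y‖ ^ 2 := by
    by_contra hno
    apply hcon
    refine ⟨ε, hε, P', hP', h, fun R₀ => ?_⟩
    by_contra hno'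
    apply hno
    refine ⟨R₀, fun y hy hh hcurl => ?_⟩
    by_contra hPy
    exact hno' ⟨y, hy, hh, hcurl, lt_of_not_ge hPy⟩
  obtain ⟨R₂, hR₂⟩ := hfar
  exact ⟨max R₁ R₂, fun y hy hh hcurl =>
    hR₁ y (le_trans (le_max_left _ _) hy) hh hcurl (hR₂ y (le_trans (le_max_right _ _) hy) hh hcurl)⟩

/-- THE LINE: «the needle parks» and the pressure face together close THE ONE STATEMENT (pure logic: the pressurised
points of `L` contradict face B at the same `ε`, `P′`, `h`). -/
theorem selfSimilarC2Needle_of_parking (hL : Sig.stub_needleParks) (hB : Sig.stub_pressureFace) :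
    Sig.stub_selfSimilarC2Needle := by
  intro ρ hρ hρ' u p H c V P hcls hss hext hC2 hnp hntame hnch hnclock hnaxis
  have hD : NeedleData ρ u p H c V P := ⟨hcls, hss, hext, hC2, hnp, hntame, hnclock, hnaxis⟩
  obtain ⟨ε, hε, P', hP', h, hio⟩ := hL ρ hρ hρ' u p H c V P hD hnch
  obtain ⟨R₂, hR₂⟩ := hB ρ hρ hρ' u p H c V P hD ε hε P' hP' h
  obtain ⟨y, hy, hh, hcurl, hPy⟩ := hio R₂
  exact absurd (hR₂ y hy hh hcurl) (not_le.mpr hPy)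

/-- The two faces together close THE ONE STATEMENT (pure logic: A and B at the same `ε` give the fast vortical channel at
A's rate `c₁`, contradicting the binder `¬ HasFastVorticalChannel`). -/
theorem selfSimilarC2Needle_of_faces (hA : Sig.stub_swirlFace) (hB : Sig.stub_pressureFace) :
    Sig.stub_selfSimilarC2Needle :=
  selfSimilarC2Needle_of_parking (needleParks_of_swirlFace hA) hB

/-- Audit form with the stubs in place: THE ONE STATEMENT from the registered stubs of this line. -/
theorem selfSimilarC2Needle_of : Sig.stub_needleParks → Sig.stub_pressureFace → Sig.stub_selfSimilarC2Needle :=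
  fun hL hB => selfSimilarC2Needle_of_parking hL hB


/-! ## REV 2 (idea-crit-8 V63 price P1, 2026-08-28): THE PINCER AT A FIXED PRESSURE LEVEL
At a far vortical point of `{ℋ_{P′} > h}` one has `P′ y = ℋ y − ½‖W y‖² + ½γ(1−γ)‖y‖²` (`selfSimilarBernoulli_apply`), so
«`P′ y ≥ (½γ(1−γ) − δ)‖y‖²`» ⇔ «`½‖W y‖² ≤ ℋ y + δ‖y‖²`» (δ-STAGNANT relative to the head).  Parked jet heads are exact
similarity-stagnation cells (`W = 0`, `P′ = ℋ + ½γ(1−γ)‖y‖²`), so the natural sharp pair is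
* `Sig.stub_needleStagnates` (L♯, «THE NEEDLE STAGNATES»): needle data ∧ ¬channel ⇒ for EVERY `δ > 0` some classical
  pressure and level admit, beyond every radius, vortical high points with `P′ y ≥ (½γ(1−γ) − δ)‖y‖²`;
* `Sig.stub_stagnationMargin` (B♯, «CAPACITY MARGIN»): needle data ⇒ for SOME `δ > 0`, every classical pressure and
  level, far vortical high points have `P′ y < (½γ(1−γ) − δ)‖y‖²` — i.e. the similarity wind never δ-stalls on the far
  vortical high set (`½‖W‖² > ℋ + δ‖y‖²`); a much smaller target for the T2 seat than B (= «∀ ε»), and the place where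
  the tree's stagnation-point algebra (`…NeedleStagnation*`: spectrum `{2γ−1, a ± ib}` of `DW` at a zero) applies.
PROVED: `selfSimilarC2Needle_of_stagnation : L♯ → B♯ → needle`, `needleParks_of_needleStagnates : L♯ → L`,
`stagnationMargin_of_pressureFace : B → B♯` (so the REV-1 line factors through the REV-2 one on the B side and the
REV-2 parking claim is the stronger one: the trade is explicit).  Stubs: 5 (`pressureFace`, `swirlFace`, `needleParks`,
`needleStagnates`, `stagnationMargin`).  No summit is proved by a line; the crux is OPEN. -/

/-- Signature of `stub_needleStagnates` (L♯, «THE NEEDLE STAGNATES», OPEN): under the needle data and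
`¬ HasFastVorticalChannel ρ V`, for EVERY `δ > 0` some classical pressure `P′` and some level `h` admit, beyond every
radius, a vortical point of `{ℋ_{P′} > h}` with `P′ y ≥ (½γ(1−γ) − δ)‖y‖²`, `γ = 1/(2+ρ)` — equivalently
`½‖W y‖² ≤ ℋ y + δ‖y‖²`.  Why plausibly true: vacuous if the needle is inconsistent; in the starting-jet portrait the
slow points forced by `¬channel` accumulate at jet heads, exact zeros `z₀` of `W` with `ℋ(z₀) > h`, near which
`½‖W‖² ≤ δ‖y‖²` and (generically) `curl V ≠ 0`.  Why it might fail: heads with IRROTATIONAL cores whose only vortical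
slow points sit in the deceleration zone at radial rate `≈ c₁` (pressurised only at level `½γ(1−γ) − ½c₁²`), or a
needle whose slow points are all brief swirl flashes (then even L fails). -/
def Sig.stub_needleStagnates : Prop :=
  ∀ ρ : ℝ, 0 < ρ → ρ ≤ 1 / 2 →
    ∀ (u : ℝ → E3 → E3) (p : ℝ → E3 → ℝ) (H : ℝ → E3 → E3 →L[ℝ] E3) (c : ℝ≥0) (V : E3 → E3) (P : E3 → ℝ),
      NeedleData ρ u p H c V P → ¬ HasFastVorticalChannel ρ V →
        ∀ δ : ℝ, 0 < δ →
          ∃ P' : E3 → ℝ, Literature.Analysis.FluidPDE.IsSelfSimilarEulerProfile (1 / (2 + ρ)) 0 V P' ∧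
            ∃ h : ℝ, ∀ R₀ : ℝ, ∃ y : E3, R₀ ≤ ‖y‖ ∧
              h < Literature.Analysis.FluidPDE.selfSimilarBernoulli (1 / (2 + ρ)) 0 V P' y ∧
                Literature.Analysis.FluidPDE.curl V y ≠ 0 ∧
                  (1 / 2 * (1 / (2 + ρ)) * (1 - 1 / (2 + ρ)) - δ) * ‖y‖ ^ 2 ≤ P' y

/-- Signature of `stub_stagnationMargin` (B♯, «CAPACITY MARGIN», OPEN — the P1-sharpened T2 target): under the needle
data there is ONE `δ > 0` such that for every classical pressure `P′` and level `h`, beyond some `R₀` every vortical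
point of `{ℋ_{P′} > h}` has `P′ y < (½γ(1−γ) − δ)‖y‖²` — the similarity wind never δ-stalls on the far vortical high
set (`½‖W y‖² > ℋ y + δ‖y‖²`).  Why it might fail: a parked head of diameter `R^{−1−ρ}` fed by a jet of width
`e^{−cR^{2+ρ}}` is locally budget-consistent (W8 D2-FEASIBILITY; `Ideas/starting-jet-needle.md`); the bet is the global
feeding bookkeeping or the head dynamics (`DW(z₀)`-spectrum vs `‖DV‖ ≍ γR/d` at the cell rim). -/
def Sig.stub_stagnationMargin : Prop :=
  ∀ ρ : ℝ, 0 < ρ → ρ ≤ 1 / 2 →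
    ∀ (u : ℝ → E3 → E3) (p : ℝ → E3 → ℝ) (H : ℝ → E3 → E3 →L[ℝ] E3) (c : ℝ≥0) (V : E3 → E3) (P : E3 → ℝ),
      NeedleData ρ u p H c V P →
        ∃ δ : ℝ, 0 < δ ∧
          ∀ P' : E3 → ℝ, Literature.Analysis.FluidPDE.IsSelfSimilarEulerProfile (1 / (2 + ρ)) 0 V P' →
            ∀ h : ℝ, ∃ R₀ : ℝ, ∀ y : E3, R₀ ≤ ‖y‖ →
              h < Literature.Analysis.FluidPDE.selfSimilarBernoulli (1 / (2 + ρ)) 0 V P' y →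
                Literature.Analysis.FluidPDE.curl V y ≠ 0 →
                  P' y < (1 / 2 * (1 / (2 + ρ)) * (1 - 1 / (2 + ρ)) - δ) * ‖y‖ ^ 2

/-- L♯ «THE NEEDLE STAGNATES»: OPEN. -/
theorem stub_needleStagnates : Sig.stub_needleStagnates := by
  sorry

/-- B♯ «CAPACITY MARGIN»: OPEN (the P1-sharpened T2 target). -/
theorem stub_stagnationMargin : Sig.stub_stagnationMargin := by
  sorry

/-- THE SHARP PINCER: L♯ and B♯ close THE ONE STATEMENT (pure logic at B♯'s `δ`). -/
theorem selfSimilarC2Needle_of_stagnation (hL : Sig.stub_needleStagnates) (hB : Sig.stub_stagnationMargin) :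
    Sig.stub_selfSimilarC2Needle := by
  intro ρ hρ hρ' u p H c V P hcls hss hext hC2 hnp hntame hnch hnclock hnaxis
  have hD : NeedleData ρ u p H c V P := ⟨hcls, hss, hext, hC2, hnp, hntame, hnclock, hnaxis⟩
  obtain ⟨δ, hδ, hBδ⟩ := hB ρ hρ hρ' u p H c V P hD
  obtain ⟨P', hP', h, hio⟩ := hL ρ hρ hρ' u p H c V P hD hnch δ hδ
  obtain ⟨R₂, hR₂⟩ := hBδ P' hP' h
  obtain ⟨y, hy, hh, hcurl, hPy⟩ := hio R₂
  exact absurd (hR₂ y hy hh hcurl) (not_lt.mpr hPy)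

/-- L♯ ⇒ L: stagnating points are pressurised at level `ε = ¼γ(1−γ)·½ …`; precisely, with `δ = ¼γ(1−γ)` the L♯ points
satisfy `P′ y ≥ ¼γ(1−γ)‖y‖² > ⅛γ(1−γ)‖y‖²` once `‖y‖ ≥ 1`. -/
theorem needleParks_of_needleStagnates (hL : Sig.stub_needleStagnates) : Sig.stub_needleParks := by
  intro ρ hρ hρ' u p H c V P hD hnch
  have hγ : 0 < 1 / (2 + ρ) := by positivity
  have hγ1 : 1 / (2 + ρ) < 1 := by
    rw [div_lt_one (by linarith)]; linarith
  have hg : 0 < (1 / (2 + ρ)) * (1 - 1 / (2 + ρ)) := mul_pos hγ (by linarith)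
  set g : ℝ := (1 / (2 + ρ)) * (1 - 1 / (2 + ρ)) with hg_def
  obtain ⟨P', hP', h, hio⟩ := hL ρ hρ hρ' u p H c V P hD hnch (g / 4) (by positivity)
  refine ⟨g / 8, by positivity, P', hP', h, fun R₀ => ?_⟩
  obtain ⟨y, hy, hh, hcurl, hPy⟩ := hio (max R₀ 1)
  have hy1 : 1 ≤ ‖y‖ := le_trans (le_max_right _ _) hy
  refine ⟨y, le_trans (le_max_left _ _) hy, hh, hcurl, lt_of_lt_of_le ?_ hPy⟩
  have hpos : 0 < ‖y‖ ^ 2 := by positivity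
  have : g / 8 < 1 / 2 * (1 / (2 + ρ)) * (1 - 1 / (2 + ρ)) - g / 4 := by
    rw [hg_def]; nlinarith
  exact mul_lt_mul_of_pos_right this hpos

/-- B ⇒ B♯: unpressurised at `ε = ⅛γ(1−γ)` is below the level `½γ(1−γ) − ¼γ(1−γ)` once `‖y‖ ≥ 1`. -/
theorem stagnationMargin_of_pressureFace (hB : Sig.stub_pressureFace) : Sig.stub_stagnationMargin := by
  intro ρ hρ hρ' u p H c V P hD
  have hγ : 0 < 1 / (2 + ρ) := by positivity
  have hγ1 : 1 / (2 + ρ) < 1 := by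
    rw [div_lt_one (by linarith)]; linarith
  have hg : 0 < (1 / (2 + ρ)) * (1 - 1 / (2 + ρ)) := mul_pos hγ (by linarith)
  set g : ℝ := (1 / (2 + ρ)) * (1 - 1 / (2 + ρ)) with hg_def
  refine ⟨g / 4, by positivity, fun P' hP' h => ?_⟩
  obtain ⟨R₁, hR₁⟩ := hB ρ hρ hρ' u p H c V P hD (g / 8) (by positivity) P' hP' h
  refine ⟨max R₁ 1, fun y hy hh hcurl => ?_⟩
  have hy1 : 1 ≤ ‖y‖ := le_trans (le_max_right _ _) hy
  have hPy := hR₁ y (le_trans (le_max_left _ _) hy) hh hcurl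
  refine lt_of_le_of_lt hPy ?_
  have hpos : 0 < ‖y‖ ^ 2 := by positivity
  have : g / 8 < 1 / 2 * (1 / (2 + ρ)) * (1 - 1 / (2 + ρ)) - g / 4 := by
    rw [hg_def]; nlinarith
  exact mul_lt_mul_of_pos_right this hpos

/-- Audit form of the sharp pincer with the stubs in place. -/
theorem selfSimilarC2Needle_of_sharp : Sig.stub_needleStagnates → Sig.stub_stagnationMargin → Sig.stub_selfSimilarC2Needle :=
  fun hL hB => selfSimilarC2Needle_of_stagnation hL hB

end Summit.NavierStokesRegularity.NavierStokesRegularity.Cruxes.PowerGaugeEulerLiouville.NeedleFaces
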